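import Summits.AtomisticToContinuum.Crystallization.Theorems.OverbindingBudgetAffineCompressedCutSharpB

/-!
# NODE g82 «SharpC», toward the open leaf NS♭₂ — part (iii), SHARP POSITIONS: the ring induction and the packaging for «Inner»
# (rider S4 of the «Sharp(β)» plan, POINTERS-g83 §4d; potential-free)

Route `OverbindingBudget` (Crystallization), crux `RobustDefectLimitWindows` (stmt-AtomisticToContinuum-31280), decomp-a2c lens 4, generation 82.
Open leaf of record: `…OverbindingBudgetAffineCompressedCutFirst….NearFieldSlackMinSecond 12 (1/25)` («NS♭₂»).  «SharpA» gave the sharp step, «SharpB» the sharp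
column `ref (±n) + x₀ ↦ (tauR ν n, dR ν n)`.  THIS FILE spreads the sharp constants over each layer and packages the result for the inner label sum:

* §1 `coord_between`, ★ `descent_between` — `…Seed.hex_descent` with COORDINATE BETWEENNESS: the basal bond `h` it removes moves every coordinate of `w`
  toward `0` (the `ℓ¹` identity `lnorm (w − h) + 6 = lnorm w` forces `|w_c − h_c| + |h_c| = |w_c|`, the equality case of the triangle inequality); this keeps
  the record's coordinate box
  `|(σ, σ, −2σ) + w|_c ≤ 18 − |ℓ|` along the descent.  `hex_mem_copy` (`hexL ⊆ Cz ℓ`, `…Seed.hexL_sub`), `tadd_descend`, `tsq_label_le` (room of every boxed label).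
* §2 ★★ `sharp_ring` — at a fixed layer `ℓ` (`|ℓ| = q`), from the sharp column site (`(tauR ν q, dR ν q)`) by induction on the hex distance `n`
  (`q + n + 1 ≤ 31`): every label `ref ℓ + x₀ + w` (`w` in-layer, `lnorm w ≤ 6n`, boxed) has its record site established with the record's chart onto `Cz ℓ`
  and `(tauR ν (q+n), dR ν (q+n))` — each step is «SharpB».`advance` along a basal bond.
* §3 `seed_flip` — the seed hypothesis for the record's frame `(ν A_i) ∘ Φ_s` (`…EstablishTwo.estab_flip` of `…SeedTwo.seed_fcc | seed_hcp`).
* §4 ★★★ `sharp_positions` — THE INPUT OF «Inner»: under the ball data, the base-frame bounds, the seed and the record's clauses 1–3 (VERBATIM, generic `B`):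
  for `ℓ ∈ [−5, 5]`, `|ℓ| = q`, an in-layer `x` with `lnorm (x − x₀) ≤ 6n`, `q + n + 1 ≤ 31`, and the clause-1 box of `ref ℓ + x`, the record site of the label
  `ref ℓ + x` is established with `(tauR ν (q + n), dR ν (q + n))` (distance `≤ 12ν`, window `[0.9026ν, 1.0347ν]`); ★ `sharp_site` adds clause 5: ANY site
  read at that label with the record's coarse resolution IS that site, so its position error is `dR ν (q + n)` (`≈ 0.0011ν … 0.036ν` for `q + n ≤ 10`,
  against the record's `0.37ν`).
With this the plan's steps S0–S4 are in place; «Inner» (g83) = the stacking-free class tables I0–I4 of POINTERS §4d against `sharp_site`.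

Deps: `…CompressedCutSharpB`.  No `instance`, no `notation`, no `set_option`, no new definitions, no axioms, 0 sorry.
-/

namespace Summit.AtomisticToContinuum.Crystallization.Theorems.OverbindingBudgetAffineCompressedCutSharpC

open Literature.Geometry.DiscreteGeometry (nearestDist nearestDist_nonneg fccTwoShellPattern hcpTwoShellPattern)
open Summit.AtomisticToContinuum.Crystallization.Theorems.OverbindingBudgetAffineCompressedCutKernel (T3 tsub tadd tsq thsum fccL fccNegL hcpL hcpAltL hexL
  tflip)
open Summit.AtomisticToContinuum.Crystallization.Theorems.OverbindingBudgetAffineCompressedCutCharts (mv)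
open Summit.AtomisticToContinuum.Crystallization.Theorems.OverbindingBudgetAffineCompressedCutEstablish (Estab tadd_tsub_cancel)
open Summit.AtomisticToContinuum.Crystallization.Theorems.OverbindingBudgetAffineCompressedCutEstablishTwo (IsSign flipIso estab_flip)
open Summit.AtomisticToContinuum.Crystallization.Theorems.OverbindingBudgetAffineCompressedCutSeedTwo (seed_fcc seed_hcp)
open Summit.AtomisticToContinuum.Crystallization.Theorems.OverbindingBudgetAffineCompressedCutSeed (InLayer lnorm eq_zero_of_lnorm_le hexL_facts inLayer_tsub
  hex_descent estab_mono tadd_zero_right hexL_sub)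
open Summit.AtomisticToContinuum.Crystallization.Theorems.OverbindingBudgetAffineCompressedCutStack (inLayer_tadd)
open Summit.AtomisticToContinuum.Crystallization.Theorems.OverbindingBudgetAffineCompressedCutPatch (InBox capv dL)
open Summit.AtomisticToContinuum.Crystallization.Theorems.OverbindingBudgetAffineCompressedCutBoxBounds (tsq_le_of_inBox tsq_tadd_axis)
open Summit.AtomisticToContinuum.Crystallization.Theorems.OverbindingBudgetAffineCompressedCutBudget (tauR dR tauR_dR_mono)
open Summit.AtomisticToContinuum.Crystallization.Theorems.OverbindingBudgetAffineCompressedCutSharpB (room record_at advance ref_form sharp_column)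
open Summit.AtomisticToContinuum.Crystallization.Theorems.OverbindingBudgetAffineCompressedCutRun (tsub_tadd_self)

variable {N : ℕ}

/-! ## §1  Descent with coordinate betweenness; copies contain the hexagon; room of boxed labels -/

/-- A coordinate step `t` with `|x − t| + |t| ≤ |x|` (the equality case of the triangle inequality) moves `x` toward `0`: `x − t` lies between `0`
and `x`. [this file] -/
theorem coord_between {x t : ℤ} (h : |x - t| + |t| ≤ |x|) :
    (0 ≤ x - t ∧ x - t ≤ x) ∨ (x ≤ x - t ∧ x - t ≤ 0) := by
  rcases abs_cases (x - t) with ⟨h1, h1'⟩ | ⟨h1, h1'⟩ <;> rcases abs_cases x with ⟨h2, h2'⟩ | ⟨h2, h2'⟩ <;>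
    rcases abs_cases t with ⟨h3, h3'⟩ | ⟨h3, h3'⟩ <;> rw [h1, h2, h3] at h <;> omega

/-- ★ **DESCENT WITH BETWEENNESS.**  A non-zero layer vector `w` is one basal bond `h ∈ hexL` away from the layer vector `w − h` of hex distance one less, and
EVERY coordinate of `w − h` lies between `0` and the corresponding coordinate of `w`. [this file] -/
theorem descent_between {w : T3} (hw : InLayer w) (hne : w ≠ (0, 0, 0)) :
    ∃ h ∈ hexL, lnorm (tsub w h) + 6 = lnorm w ∧ InLayer (tsub w h) ∧
      ((0 ≤ (tsub w h).1 ∧ (tsub w h).1 ≤ w.1) ∨ (w.1 ≤ (tsub w h).1 ∧ (tsub w h).1 ≤ 0)) ∧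
      ((0 ≤ (tsub w h).2.1 ∧ (tsub w h).2.1 ≤ w.2.1) ∨ (w.2.1 ≤ (tsub w h).2.1 ∧ (tsub w h).2.1 ≤ 0)) ∧
      ((0 ≤ (tsub w h).2.2 ∧ (tsub w h).2.2 ≤ w.2.2) ∨ (w.2.2 ≤ (tsub w h).2.2 ∧ (tsub w h).2.2 ≤ 0)) := by
  obtain ⟨h, hh, hd⟩ := hex_descent hw hne
  refine ⟨h, hh, hd, inLayer_tsub hw (hexL_facts h hh).1, ?_⟩
  obtain ⟨a, b, c⟩ := w
  obtain ⟨t₁, t₂, t₃⟩ := h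
  have hsum : |t₁| + |t₂| + |t₃| = 6 := by
    simp only [hexL, List.mem_cons, List.not_mem_nil, or_false, Prod.mk.injEq] at hh
    rcases hh with ⟨rfl, rfl, rfl⟩ | ⟨rfl, rfl, rfl⟩ | ⟨rfl, rfl, rfl⟩ | ⟨rfl, rfl, rfl⟩ | ⟨rfl, rfl, rfl⟩ | ⟨rfl, rfl, rfl⟩ <;> norm_num
  simp only [lnorm, tsub] at hd ⊢
  have i1 := abs_add_le (a - t₁) t₁
  have i2 := abs_add_le (b - t₂) t₂
  have i3 := abs_add_le (c - t₃) t₃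
  simp only [sub_add_cancel] at i1 i2 i3
  exact ⟨coord_between (by omega), coord_between (by omega), coord_between (by omega)⟩

/-- Every admissible copy contains the basal hexagon. [this file] -/
theorem hex_mem_copy {C : List T3} (hC : C ∈ [fccL, fccNegL, hcpL, hcpAltL]) : ∀ h ∈ hexL, h ∈ C := by
  simp only [List.mem_cons, List.not_mem_nil, or_false] at hC
  rcases hC with rfl | rfl | rfl | rfl
  · exact hexL_sub.2.2.1
  · exact hexL_sub.2.2.2.1
  · exact hexL_sub.1
  · exact hexL_sub.2.1

/-- `(R + (x₀ + (w − h))) + h = R + (x₀ + w)`. [this file] -/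
theorem tadd_descend (R x₀ w h : T3) : tadd (tadd R (tadd x₀ (tsub w h))) h = tadd R (tadd x₀ w) := by
  obtain ⟨R₁, R₂, R₃⟩ := R
  obtain ⟨a₁, a₂, a₃⟩ := x₀
  obtain ⟨w₁, w₂, w₃⟩ := w
  obtain ⟨h₁, h₂, h₃⟩ := h
  simp only [tadd, tsub]
  refine Prod.ext ?_ (Prod.ext ?_ ?_) <;> dsimp only <;> ring

/-- **Room of a boxed label**: `|ℓ| ≤ 5`, `u` sum-zero with `|u_c| ≤ 18` ⟹ `tsq (2ℓ(1,1,1) + u) = 12ℓ² + tsq u ≤ 300 + 648`. [this file] -/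
theorem tsq_label_le {ℓ : ℤ} (hℓ : -5 ≤ ℓ ∧ ℓ ≤ 5) {u : T3} (hu : thsum u = 0) (h1 : |u.1| ≤ 18) (h2 : |u.2.1| ≤ 18) (h3 : |u.2.2| ≤ 18) :
    tsq (tadd (2 * ℓ, 2 * ℓ, 2 * ℓ) u) ≤ 948 := by
  have hb : InBox (0, 0, 0) 18 u := by
    refine ⟨?_, ?_, ?_⟩ <;> simp only [add_zero] <;> assumption
  have hq := tsq_le_of_inBox hu hb
  rw [tsq_tadd_axis (2 * ℓ) hu]
  nlinarith

/-! ## §2  THE SHARP RING INDUCTION at a fixed layer -/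

/-- ★★ **SHARP RING.**  Layer `ℓ ∈ [−5, 5]`, `|ℓ| = q`; the column label `ref ℓ + x₀ = (2ℓ + σ, 2ℓ + σ, 2ℓ − 2σ)` (`|σ| ≤ 5`) with its record site established SHARP
`(tauR ν q, dR ν q)`; `q + n + 1 ≤ 31`.  Then every in-layer `w` with `lnorm w ≤ 6n` whose label `ref ℓ + x₀ + w` is boxed (`|(σ,σ,−2σ) + w|_c ≤ 18 − |ℓ|`) has
its record site established with the record's chart onto `Cz ℓ` and `(tauR ν (q + n), dR ν (q + n))`. [this file] -/
theorem sharp_ring {y : Fin N → EuclideanSpace ℝ (Fin 3)} (hy : Function.Injective y) {i : Fin N} (hν : 0 < nearestDist y i)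
    {A : Fin N → (EuclideanSpace ℝ (Fin 3) →ₗ[ℝ] EuclideanSpace ℝ (Fin 3))} {Qf : Fin N → (EuclideanSpace ℝ (Fin 3) →ₗᵢ[ℝ] EuclideanSpace ℝ (Fin 3))}
    {P : Fin N → Finset (EuclideanSpace ℝ (Fin 3))} {f : Fin N → EuclideanSpace ℝ (Fin 3) → EuclideanSpace ℝ (Fin 3)}
    {B : EuclideanSpace ℝ (Fin 3) →ₗ[ℝ] EuclideanSpace ℝ (Fin 3)}
    (hP : ∀ j, dist (y j) (y i) ≤ 12 * nearestDist y i → (P j = fccTwoShellPattern ∨ P j = hcpTwoShellPattern))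
    (hA : ∀ j, dist (y j) (y i) ≤ 12 * nearestDist y i → ∀ v ∈ P j, ‖A j v - Qf j v‖ ≤ 1 / 1000)
    (hf : ∀ j, dist (y j) (y i) ≤ 12 * nearestDist y i → ∀ v ∈ P j,
      f j v ∈ Set.range y ∧ dist (f j v) (y j + nearestDist y j • A j v) ≤ 1 / 10 ^ 4 * nearestDist y j)
    (hinj : ∀ j, dist (y j) (y i) ≤ 12 * nearestDist y i → Set.InjOn (f j) ↑(P j))
    (hex : ∀ j, dist (y j) (y i) ≤ 12 * nearestDist y i → ∀ m, m ≠ j → dist (y m) (y j) ≤ (3 / 2 + 1 / 450) * nearestDist y j →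
      ∃ v ∈ P j, f j v = y m)
    (hBlo : ∀ z, 399 / 400 * nearestDist y i * ‖z‖ ≤ ‖B z‖) (hBup : ∀ z, ‖B z‖ ≤ 401 / 400 * nearestDist y i * ‖z‖)
    {ref : ℤ → T3} {Cz : ℤ → List T3}
    (hRec1 : ∀ ℓ : ℤ, -5 ≤ ℓ → ℓ ≤ 5 → Cz ℓ ∈ [fccL, fccNegL, hcpL, hcpAltL] ∧ thsum (ref ℓ) = 6 * ℓ ∧ (ref ℓ).2.1 = (ref ℓ).1 ∧
      (3 : ℤ) ∣ ((ref ℓ).2.1 - (ref ℓ).2.2) ∧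
      ∀ u : T3, InLayer (tsub (tadd (2 * ℓ, 2 * ℓ, 2 * ℓ) u) (ref ℓ)) → |u.1| ≤ 18 - |ℓ| → |u.2.1| ≤ 18 - |ℓ| → |u.2.2| ≤ 18 - |ℓ| →
        ∃ k : Fin N, ∃ M : EuclideanSpace ℝ (Fin 3) →ₗᵢ[ℝ] EuclideanSpace ℝ (Fin 3),
          dist (y k) (y i) ≤ 12 * nearestDist y i ∧ 9026 / 10000 * nearestDist y i ≤ nearestDist y k ∧
          nearestDist y k ≤ 10347 / 10000 * nearestDist y i ∧
          Estab y A P B i k M (Cz ℓ) (tadd (2 * ℓ, 2 * ℓ, 2 * ℓ) u) (tauR (nearestDist y i) 31) (dR (nearestDist y i) 31))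
    {x₀ : T3} (hx₀L : InLayer x₀) {ℓ : ℤ} (hℓ1 : -5 ≤ ℓ) (hℓ2 : ℓ ≤ 5) {q : ℕ} (hq : (q : ℤ) = |ℓ|) {σ : ℤ} (hσ : |σ| ≤ 5)
    (hL1 : (tadd (ref ℓ) x₀).1 = 2 * ℓ + σ) (hL2 : (tadd (ref ℓ) x₀).2.1 = 2 * ℓ + σ) (hL3 : (tadd (ref ℓ) x₀).2.2 = 2 * ℓ - 2 * σ)
    (hcol : ∃ k : Fin N, ∃ M : EuclideanSpace ℝ (Fin 3) →ₗᵢ[ℝ] EuclideanSpace ℝ (Fin 3),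
      dist (y k) (y i) ≤ 12 * nearestDist y i ∧ 9026 / 10000 * nearestDist y i ≤ nearestDist y k ∧
      nearestDist y k ≤ 10347 / 10000 * nearestDist y i ∧
      Estab y A P B i k M (Cz ℓ) (tadd (ref ℓ) x₀) (tauR (nearestDist y i) q) (dR (nearestDist y i) q))
    (n : ℕ) (hn : q + n + 1 ≤ 31) :
    ∀ w : T3, InLayer w → lnorm w ≤ 6 * (n : ℤ) → |σ + w.1| ≤ 18 - |ℓ| → |σ + w.2.1| ≤ 18 - |ℓ| → |-2 * σ + w.2.2| ≤ 18 - |ℓ| →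
      ∃ k : Fin N, ∃ M : EuclideanSpace ℝ (Fin 3) →ₗᵢ[ℝ] EuclideanSpace ℝ (Fin 3),
        dist (y k) (y i) ≤ 12 * nearestDist y i ∧ 9026 / 10000 * nearestDist y i ≤ nearestDist y k ∧
        nearestDist y k ≤ 10347 / 10000 * nearestDist y i ∧
        Estab y A P B i k M (Cz ℓ) (tadd (ref ℓ) (tadd x₀ w)) (tauR (nearestDist y i) (q + n)) (dR (nearestDist y i) (q + n)) := by
  obtain ⟨hs1, hs2⟩ := abs_le.mp hσ
  have hℓabs : |ℓ| ≤ 5 := abs_le.mpr ⟨hℓ1, hℓ2⟩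
  induction n with
  | zero =>
    intro w hw hln _ _ _
    have hw0 := eq_zero_of_lnorm_le w (by simpa using hln)
    subst hw0
    rw [tadd_zero_right]
    simpa using hcol
  | succ m ih =>
    intro w hw hln hb1 hb2 hb3
    by_cases hw0 : w = (0, 0, 0)
    · subst hw0
      rw [tadd_zero_right]
      obtain ⟨k, M, h1, h2, h3, hE⟩ := hcol
      obtain ⟨-, hτ, -, hD⟩ := tauR_dR_mono hν.le (by omega : q ≤ q + (m + 1))
      exact ⟨k, M, h1, h2, h3, estab_mono hE hτ hD⟩
    obtain ⟨h, hh, hd, hw', c1, c2, c3⟩ := descent_between hw hw0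
    have hln' : lnorm (tsub w h) ≤ 6 * (m : ℤ) := by push_cast at hln; omega
    obtain ⟨e1, e2⟩ := abs_le.mp hb1
    obtain ⟨e3, e4⟩ := abs_le.mp hb2
    obtain ⟨e5, e6⟩ := abs_le.mp hb3
    have hb1' : |σ + (tsub w h).1| ≤ 18 - |ℓ| := abs_le.mpr ⟨by rcases c1 with c | c <;> omega, by rcases c1 with c | c <;> omega⟩
    have hb2' : |σ + (tsub w h).2.1| ≤ 18 - |ℓ| := abs_le.mpr ⟨by rcases c2 with c | c <;> omega, by rcases c2 with c | c <;> omega⟩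
    have hb3' : |-2 * σ + (tsub w h).2.2| ≤ 18 - |ℓ| := abs_le.mpr ⟨by rcases c3 with c | c <;> omega, by rcases c3 with c | c <;> omega⟩
    obtain ⟨k, M, hk12, -, hkhi, hE⟩ := ih (by omega) (tsub w h) hw' hln' hb1' hb2' hb3'
    have hxC : h ∈ Cz ℓ := hex_mem_copy (hRec1 ℓ hℓ1 hℓ2).1 h hh
    have hx18 : tsq h = 18 := (hexL_facts h hh).2
    have hlab : tadd (tadd (ref ℓ) (tadd x₀ (tsub w h))) h = tadd (ref ℓ) (tadd x₀ w) := tadd_descend _ _ _ _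
    have hL : InLayer (tsub (tadd (ref ℓ) (tadd x₀ w)) (ref ℓ)) := by rw [tsub_tadd_self]; exact inLayer_tadd hx₀L hw
    have eL : tadd (ref ℓ) (tadd x₀ w) = tadd (2 * ℓ, 2 * ℓ, 2 * ℓ) (σ + w.1, σ + w.2.1, -2 * σ + w.2.2) := by
      simp only [tadd] at hL1 hL2 hL3 ⊢
      refine Prod.ext ?_ (Prod.ext ?_ ?_) <;> dsimp only <;> omega
    have eu : tsub (tadd (ref ℓ) (tadd x₀ w)) (2 * ℓ, 2 * ℓ, 2 * ℓ) = (σ + w.1, σ + w.2.1, -2 * σ + w.2.2) := by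
      rw [eL, tsub_tadd_self]
    obtain ⟨k', M', hk'12, hk'lo, hk'hi, hE'⟩ := record_at hRec1 hℓ1 hℓ2 hL (by rw [eu]; exact ⟨hb1, hb2, hb3⟩)
    rw [← hlab] at hE'
    have h18 : (18 : ℤ) - |ℓ| ≤ 18 := by linarith [abs_nonneg ℓ]
    have hroom : ‖B (mv (tadd (tadd (ref ℓ) (tadd x₀ (tsub w h))) h))‖ ≤ 15 / 2 * nearestDist y i := by
      rw [hlab, eL]
      exact room hν.le hBup (tsq_label_le ⟨hℓ1, hℓ2⟩ (by have := hw.1; simp only [thsum]; omega) (hb1.trans h18) (hb2.trans h18)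
        (hb3.trans h18))
    have hadv := advance hy hν hP hA hf hinj hex hBlo (p := q + m) (by omega) hk12 hkhi hE hxC hx18 hroom hk'lo hk'hi hE'
    rw [hlab] at hadv
    have e7 : q + (m + 1) = q + m + 1 := by omega
    rw [e7]
    exact ⟨k', M', hk'12, hk'lo, hk'hi, hadv⟩

/-! ## §3  The seed for the record's frame -/

/-- **SEED IN THE RECORD'S FRAME.**  For `P i ∈ {fcc, hcp}` and a sign `s`, the base frame `(ν A_i) ∘ Φ_s` admits a chart of `i` with label `0` and `τ = D = 0`
(`Φ_s` itself, onto the flipped `F⁺` or `H`). [this file] -/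
theorem seed_flip {y : Fin N → EuclideanSpace ℝ (Fin 3)} {A : Fin N → (EuclideanSpace ℝ (Fin 3) →ₗ[ℝ] EuclideanSpace ℝ (Fin 3))}
    {P : Fin N → Finset (EuclideanSpace ℝ (Fin 3))} {i : Fin N} (hPi : P i = fccTwoShellPattern ∨ P i = hcpTwoShellPattern) {s : T3} (hs : IsSign s) :
    ∃ (M₀ : EuclideanSpace ℝ (Fin 3) →ₗᵢ[ℝ] EuclideanSpace ℝ (Fin 3)) (C₀ : List T3),
      Estab y A P ((nearestDist y i • A i) ∘ₗ (flipIso s hs).toLinearMap) i i M₀ C₀ (0, 0, 0) 0 0 := by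
  have h0 : tflip s (0, 0, 0) = (0, 0, 0) := by simp [tflip]
  rcases hPi with h | h
  · have hE := estab_flip hs (seed_fcc (y := y) (A := A) h)
    rw [h0] at hE
    exact ⟨_, _, hE⟩
  · have hE := estab_flip hs (seed_hcp (y := y) (A := A) h)
    rw [h0] at hE
    exact ⟨_, _, hE⟩

/-! ## §4  SHARP POSITIONS — the packaging for «Inner» -/

/-- ★★★ **SHARP POSITIONS.**  Ball data at `i` (radius `12·nn_i`), base frame `B` with `(399/400)ν‖z‖ ≤ ‖Bz‖ ≤ (401/400)ν‖z‖`, a seed, the record's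
clauses 1–3.  For `ℓ ∈ [−5, 5]` with `|ℓ| = q`, an in-layer `x` with `lnorm (x − x₀) ≤ 6n`, `q + n + 1 ≤ 31`, and the clause-1 box of the label `ref ℓ + x`:
the record site of `ref ℓ + x` is established with the record's chart onto `Cz ℓ` and `(tauR ν (q + n), dR ν (q + n))`. [this file] -/
theorem sharp_positions {y : Fin N → EuclideanSpace ℝ (Fin 3)} (hy : Function.Injective y) {i : Fin N} (hν : 0 < nearestDist y i)
    {A : Fin N → (EuclideanSpace ℝ (Fin 3) →ₗ[ℝ] EuclideanSpace ℝ (Fin 3))} {Qf : Fin N → (EuclideanSpace ℝ (Fin 3) →ₗᵢ[ℝ] EuclideanSpace ℝ (Fin 3))}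
    {P : Fin N → Finset (EuclideanSpace ℝ (Fin 3))} {f : Fin N → EuclideanSpace ℝ (Fin 3) → EuclideanSpace ℝ (Fin 3)}
    {B : EuclideanSpace ℝ (Fin 3) →ₗ[ℝ] EuclideanSpace ℝ (Fin 3)}
    (hP : ∀ j, dist (y j) (y i) ≤ 12 * nearestDist y i → (P j = fccTwoShellPattern ∨ P j = hcpTwoShellPattern))
    (hA : ∀ j, dist (y j) (y i) ≤ 12 * nearestDist y i → ∀ v ∈ P j, ‖A j v - Qf j v‖ ≤ 1 / 1000)
    (hf : ∀ j, dist (y j) (y i) ≤ 12 * nearestDist y i → ∀ v ∈ P j,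
      f j v ∈ Set.range y ∧ dist (f j v) (y j + nearestDist y j • A j v) ≤ 1 / 10 ^ 4 * nearestDist y j)
    (hinj : ∀ j, dist (y j) (y i) ≤ 12 * nearestDist y i → Set.InjOn (f j) ↑(P j))
    (hex : ∀ j, dist (y j) (y i) ≤ 12 * nearestDist y i → ∀ m, m ≠ j → dist (y m) (y j) ≤ (3 / 2 + 1 / 450) * nearestDist y j →
      ∃ v ∈ P j, f j v = y m)
    (hBlo : ∀ z, 399 / 400 * nearestDist y i * ‖z‖ ≤ ‖B z‖) (hBup : ∀ z, ‖B z‖ ≤ 401 / 400 * nearestDist y i * ‖z‖)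
    (hseed : ∃ (M₀ : EuclideanSpace ℝ (Fin 3) →ₗᵢ[ℝ] EuclideanSpace ℝ (Fin 3)) (C₀ : List T3), Estab y A P B i i M₀ C₀ (0, 0, 0) 0 0)
    {ref : ℤ → T3} {Cz : ℤ → List T3} {e : ℤ → ℤ} {x₀ : T3}
    (hRec1 : ∀ ℓ : ℤ, -5 ≤ ℓ → ℓ ≤ 5 → Cz ℓ ∈ [fccL, fccNegL, hcpL, hcpAltL] ∧ thsum (ref ℓ) = 6 * ℓ ∧ (ref ℓ).2.1 = (ref ℓ).1 ∧
      (3 : ℤ) ∣ ((ref ℓ).2.1 - (ref ℓ).2.2) ∧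
      ∀ u : T3, InLayer (tsub (tadd (2 * ℓ, 2 * ℓ, 2 * ℓ) u) (ref ℓ)) → |u.1| ≤ 18 - |ℓ| → |u.2.1| ≤ 18 - |ℓ| → |u.2.2| ≤ 18 - |ℓ| →
        ∃ k : Fin N, ∃ M : EuclideanSpace ℝ (Fin 3) →ₗᵢ[ℝ] EuclideanSpace ℝ (Fin 3),
          dist (y k) (y i) ≤ 12 * nearestDist y i ∧ 9026 / 10000 * nearestDist y i ≤ nearestDist y k ∧
          nearestDist y k ≤ 10347 / 10000 * nearestDist y i ∧
          Estab y A P B i k M (Cz ℓ) (tadd (2 * ℓ, 2 * ℓ, 2 * ℓ) u) (tauR (nearestDist y i) 31) (dR (nearestDist y i) 31))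
    (hRec2 : ∀ ℓ : ℤ, -5 ≤ ℓ → ℓ ≤ 4 → (e ℓ = 1 ∨ e ℓ = -1) ∧ ref (ℓ + 1) = tadd (ref ℓ) (capv 1 (e ℓ) (1, 1, -2)) ∧
      (∀ δ ∈ dL, capv 1 (e ℓ) δ ∈ Cz ℓ) ∧ (∀ δ ∈ dL, capv (-1) (-(e ℓ)) δ ∈ Cz (ℓ + 1)))
    (hx₀L : InLayer x₀) (hx₀ : tadd (ref 0) x₀ = (0, 0, 0))
    {ℓ : ℤ} (hℓ1 : -5 ≤ ℓ) (hℓ2 : ℓ ≤ 5) {q : ℕ} (hq : (q : ℤ) = |ℓ|) {n : ℕ} (hn : q + n + 1 ≤ 31) {x : T3} (hx : InLayer x)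
    (hln : lnorm (tsub x x₀) ≤ 6 * (n : ℤ))
    (hbox : |(tsub (tadd (ref ℓ) x) (2 * ℓ, 2 * ℓ, 2 * ℓ)).1| ≤ 18 - |ℓ| ∧ |(tsub (tadd (ref ℓ) x) (2 * ℓ, 2 * ℓ, 2 * ℓ)).2.1| ≤ 18 - |ℓ| ∧
      |(tsub (tadd (ref ℓ) x) (2 * ℓ, 2 * ℓ, 2 * ℓ)).2.2| ≤ 18 - |ℓ|) :
    ∃ k : Fin N, ∃ M : EuclideanSpace ℝ (Fin 3) →ₗᵢ[ℝ] EuclideanSpace ℝ (Fin 3),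
      dist (y k) (y i) ≤ 12 * nearestDist y i ∧ 9026 / 10000 * nearestDist y i ≤ nearestDist y k ∧
      nearestDist y k ≤ 10347 / 10000 * nearestDist y i ∧
      Estab y A P B i k M (Cz ℓ) (tadd (ref ℓ) x) (tauR (nearestDist y i) (q + n)) (dR (nearestDist y i) (q + n)) := by
  have hq5 : q ≤ 5 := by
    have h5 : |ℓ| ≤ 5 := abs_le.mpr ⟨hℓ1, hℓ2⟩
    omega
  -- the column site of layer `ℓ` and the shape of its label
  obtain ⟨σ, hσ, hL1, hL2, hL3, hcol⟩ : ∃ σ : ℤ, |σ| ≤ 5 ∧ (tadd (ref ℓ) x₀).1 = 2 * ℓ + σ ∧ (tadd (ref ℓ) x₀).2.1 = 2 * ℓ + σ ∧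
      (tadd (ref ℓ) x₀).2.2 = 2 * ℓ - 2 * σ ∧
      ∃ k : Fin N, ∃ M : EuclideanSpace ℝ (Fin 3) →ₗᵢ[ℝ] EuclideanSpace ℝ (Fin 3),
        dist (y k) (y i) ≤ 12 * nearestDist y i ∧ 9026 / 10000 * nearestDist y i ≤ nearestDist y k ∧
        nearestDist y k ≤ 10347 / 10000 * nearestDist y i ∧
        Estab y A P B i k M (Cz ℓ) (tadd (ref ℓ) x₀) (tauR (nearestDist y i) q) (dR (nearestDist y i) q) := by
    have hc := sharp_column hy hν hP hA hf hinj hex hBlo hBup hseed hRec1 hRec2 hx₀L hx₀ q hq5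
    have hr := ref_form hRec2 hx₀ q hq5
    rcases le_or_gt 0 ℓ with hpos | hneg
    · have hℓq : ℓ = (q : ℤ) := by rw [abs_of_nonneg hpos] at hq; omega
      subst hℓq
      obtain ⟨⟨σ, hσ, -, hLσ⟩, -⟩ := hr
      exact ⟨σ, hσ.trans (by exact_mod_cast hq5), by rw [hLσ], by rw [hLσ], by rw [hLσ], hc.1⟩
    · have hℓq : ℓ = -(q : ℤ) := by rw [abs_of_neg hneg] at hq; omega
      subst hℓq
      obtain ⟨-, ⟨σ, hσ, -, hLσ⟩⟩ := hr
      exact ⟨σ, hσ.trans (by exact_mod_cast hq5), by rw [hLσ]; dsimp only; ring, by rw [hLσ]; dsimp only; ring,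
        by rw [hLσ]; dsimp only; ring, hc.2⟩
  have hw : InLayer (tsub x x₀) := inLayer_tsub hx hx₀L
  have ex : tadd x₀ (tsub x x₀) = x := tadd_tsub_cancel x₀ x
  have e1 : σ + (tsub x x₀).1 = (tsub (tadd (ref ℓ) x) (2 * ℓ, 2 * ℓ, 2 * ℓ)).1 := by
    simp only [tadd, tsub] at hL1 ⊢; linarith
  have e2 : σ + (tsub x x₀).2.1 = (tsub (tadd (ref ℓ) x) (2 * ℓ, 2 * ℓ, 2 * ℓ)).2.1 := by
    simp only [tadd, tsub] at hL2 ⊢; linarith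
  have e3 : -2 * σ + (tsub x x₀).2.2 = (tsub (tadd (ref ℓ) x) (2 * ℓ, 2 * ℓ, 2 * ℓ)).2.2 := by
    simp only [tadd, tsub] at hL3 ⊢; linarith
  obtain ⟨k, M, h1, h2, h3, hE⟩ := sharp_ring hy hν hP hA hf hinj hex hBlo hBup hRec1 hx₀L hℓ1 hℓ2 hq hσ hL1 hL2 hL3 hcol n hn (tsub x x₀) hw hln
    (by rw [e1]; exact hbox.1) (by rw [e2]; exact hbox.2.1) (by rw [e3]; exact hbox.2.2)
  rw [ex] at hE
  exact ⟨k, M, h1, h2, h3, hE⟩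

/-- ★ **SHARP SITE** (adds clause 5 of the record).  A site `m` read at the label `ref ℓ + x` with the record's coarse resolution
`dR ν 31 + 10⁻⁴·(1.0347ν) + tauR ν 31` IS the record site of that label, hence its position error is the sharp `dR ν (q + n)` and its window is
`[0.9026ν, 1.0347ν]`. [this file] -/
theorem sharp_site {y : Fin N → EuclideanSpace ℝ (Fin 3)} (hy : Function.Injective y) {i : Fin N} (hν : 0 < nearestDist y i)
    {A : Fin N → (EuclideanSpace ℝ (Fin 3) →ₗ[ℝ] EuclideanSpace ℝ (Fin 3))} {Qf : Fin N → (EuclideanSpace ℝ (Fin 3) →ₗᵢ[ℝ] EuclideanSpace ℝ (Fin 3))}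
    {P : Fin N → Finset (EuclideanSpace ℝ (Fin 3))} {f : Fin N → EuclideanSpace ℝ (Fin 3) → EuclideanSpace ℝ (Fin 3)}
    {B : EuclideanSpace ℝ (Fin 3) →ₗ[ℝ] EuclideanSpace ℝ (Fin 3)}
    (hP : ∀ j, dist (y j) (y i) ≤ 12 * nearestDist y i → (P j = fccTwoShellPattern ∨ P j = hcpTwoShellPattern))
    (hA : ∀ j, dist (y j) (y i) ≤ 12 * nearestDist y i → ∀ v ∈ P j, ‖A j v - Qf j v‖ ≤ 1 / 1000)
    (hf : ∀ j, dist (y j) (y i) ≤ 12 * nearestDist y i → ∀ v ∈ P j,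
      f j v ∈ Set.range y ∧ dist (f j v) (y j + nearestDist y j • A j v) ≤ 1 / 10 ^ 4 * nearestDist y j)
    (hinj : ∀ j, dist (y j) (y i) ≤ 12 * nearestDist y i → Set.InjOn (f j) ↑(P j))
    (hex : ∀ j, dist (y j) (y i) ≤ 12 * nearestDist y i → ∀ m, m ≠ j → dist (y m) (y j) ≤ (3 / 2 + 1 / 450) * nearestDist y j →
      ∃ v ∈ P j, f j v = y m)
    (hBlo : ∀ z, 399 / 400 * nearestDist y i * ‖z‖ ≤ ‖B z‖) (hBup : ∀ z, ‖B z‖ ≤ 401 / 400 * nearestDist y i * ‖z‖)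
    (hseed : ∃ (M₀ : EuclideanSpace ℝ (Fin 3) →ₗᵢ[ℝ] EuclideanSpace ℝ (Fin 3)) (C₀ : List T3), Estab y A P B i i M₀ C₀ (0, 0, 0) 0 0)
    {ref : ℤ → T3} {Cz : ℤ → List T3} {e : ℤ → ℤ} {x₀ : T3}
    (hRec1 : ∀ ℓ : ℤ, -5 ≤ ℓ → ℓ ≤ 5 → Cz ℓ ∈ [fccL, fccNegL, hcpL, hcpAltL] ∧ thsum (ref ℓ) = 6 * ℓ ∧ (ref ℓ).2.1 = (ref ℓ).1 ∧
      (3 : ℤ) ∣ ((ref ℓ).2.1 - (ref ℓ).2.2) ∧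
      ∀ u : T3, InLayer (tsub (tadd (2 * ℓ, 2 * ℓ, 2 * ℓ) u) (ref ℓ)) → |u.1| ≤ 18 - |ℓ| → |u.2.1| ≤ 18 - |ℓ| → |u.2.2| ≤ 18 - |ℓ| →
        ∃ k : Fin N, ∃ M : EuclideanSpace ℝ (Fin 3) →ₗᵢ[ℝ] EuclideanSpace ℝ (Fin 3),
          dist (y k) (y i) ≤ 12 * nearestDist y i ∧ 9026 / 10000 * nearestDist y i ≤ nearestDist y k ∧
          nearestDist y k ≤ 10347 / 10000 * nearestDist y i ∧
          Estab y A P B i k M (Cz ℓ) (tadd (2 * ℓ, 2 * ℓ, 2 * ℓ) u) (tauR (nearestDist y i) 31) (dR (nearestDist y i) 31))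
    (hRec2 : ∀ ℓ : ℤ, -5 ≤ ℓ → ℓ ≤ 4 → (e ℓ = 1 ∨ e ℓ = -1) ∧ ref (ℓ + 1) = tadd (ref ℓ) (capv 1 (e ℓ) (1, 1, -2)) ∧
      (∀ δ ∈ dL, capv 1 (e ℓ) δ ∈ Cz ℓ) ∧ (∀ δ ∈ dL, capv (-1) (-(e ℓ)) δ ∈ Cz (ℓ + 1)))
    (hx₀L : InLayer x₀) (hx₀ : tadd (ref 0) x₀ = (0, 0, 0))
    (hRec5 : ∀ (m m' : Fin N) (r : T3), 9967 / 10000 * (9026 / 10000 * nearestDist y i) ≤ nearestDist y m' →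
      ‖y m - y i - B (mv r)‖ ≤ dR (nearestDist y i) 31 + 1 / 10 ^ 4 * (10347 / 10000 * nearestDist y i) + tauR (nearestDist y i) 31 →
      ‖y m' - y i - B (mv r)‖ ≤ dR (nearestDist y i) 31 + 1 / 10 ^ 4 * (10347 / 10000 * nearestDist y i) + tauR (nearestDist y i) 31 → m = m')
    {ℓ : ℤ} (hℓ1 : -5 ≤ ℓ) (hℓ2 : ℓ ≤ 5) {q : ℕ} (hq : (q : ℤ) = |ℓ|) {n : ℕ} (hn : q + n + 1 ≤ 31) {x : T3} (hx : InLayer x)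
    (hln : lnorm (tsub x x₀) ≤ 6 * (n : ℤ))
    (hbox : |(tsub (tadd (ref ℓ) x) (2 * ℓ, 2 * ℓ, 2 * ℓ)).1| ≤ 18 - |ℓ| ∧ |(tsub (tadd (ref ℓ) x) (2 * ℓ, 2 * ℓ, 2 * ℓ)).2.1| ≤ 18 - |ℓ| ∧
      |(tsub (tadd (ref ℓ) x) (2 * ℓ, 2 * ℓ, 2 * ℓ)).2.2| ≤ 18 - |ℓ|)
    {m : Fin N} (hm : ‖y m - y i - B (mv (tadd (ref ℓ) x))‖ ≤
      dR (nearestDist y i) 31 + 1 / 10 ^ 4 * (10347 / 10000 * nearestDist y i) + tauR (nearestDist y i) 31) :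
    ‖y m - y i - B (mv (tadd (ref ℓ) x))‖ ≤ dR (nearestDist y i) (q + n) ∧ 9026 / 10000 * nearestDist y i ≤ nearestDist y m ∧
      nearestDist y m ≤ 10347 / 10000 * nearestDist y i := by
  obtain ⟨k, M, -, hlo, hhi, hE⟩ :=
    sharp_positions hy hν hP hA hf hinj hex hBlo hBup hseed hRec1 hRec2 hx₀L hx₀ hℓ1 hℓ2 hq hn hx hln hbox
  obtain ⟨hτ0, hτ, -, hD⟩ := tauR_dR_mono hν.le (by omega : q + n ≤ 31)
  have h0 : 0 ≤ 1 / 10 ^ 4 * (10347 / 10000 * nearestDist y i) := by positivity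
  have hk : ‖y k - y i - B (mv (tadd (ref ℓ) x))‖ ≤
      dR (nearestDist y i) 31 + 1 / 10 ^ 4 * (10347 / 10000 * nearestDist y i) + tauR (nearestDist y i) 31 := by
    linarith [hE.2.2]
  have hmk : m = k := hRec5 m k _ (by nlinarith [hν.le]) hm hk
  subst hmk
  exact ⟨hE.2.2, hlo, hhi⟩

end Summit.AtomisticToContinuum.Crystallization.Theorems.OverbindingBudgetAffineCompressedCutSharpC
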